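import Mathlib
import Summits.Ventures.PercRepro2.PMK5Deg3Kernel
import Summits.Ventures.PercRepro2.PMK5Deg3LitsOUB
import Summits.Ventures.PercRepro2.PMK5Deg3CertsOUB1
import Summits.Ventures.PercRepro2.PMK5Deg3CertsOUB2
import Summits.Ventures.PercRepro2.PMK5Deg3CertsOUB3
import Summits.Ventures.PercRepro2.PMK5Deg3CertsOUB4
import Summits.Ventures.PercRepro2.Deg3Conn
import Summits.Ventures.PercRepro2.Deg3Typed

/-!
# THEOREM 28 ON THE TRIPLE `(o, u, b)`: ROW 2′TRI AND (HCOV) ON `K₅ + {a₃o, a₃u, a₃b}` FOR EVERY WEIGHT VECTOR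
(blind cell PercRepro2, mine-2 g27)

The sixteen slice certificates `cert_oub` and the certified literals `litOK_oub`, read through the slice
decomposition and the digit bridge by `Deg3Typed.HCov_deg3`.  Standard axioms only.
-/

namespace Summit.Ventures.PercRepro2

namespace Deg3

/-- **All sixteen slice certificates of the triple `(0, 3, 4)`.** -/
theorem cert_oub : Cert Loub := by
  intro j₁ j₂
  fin_cases j₁ <;> fin_cases j₂
  · exact certS_oub_00
  · exact certS_oub_01
  · exact certS_oub_02
  · exact certS_oub_03
  · exact certS_oub_10
  · exact certS_oub_11
  · exact certS_oub_12
  · exact certS_oub_13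
  · exact certS_oub_20
  · exact certS_oub_21
  · exact certS_oub_22
  · exact certS_oub_23
  · exact certS_oub_30
  · exact certS_oub_31
  · exact certS_oub_32
  · exact certS_oub_33

variable {R : Type*} [Field R] [LinearOrder R] [IsStrictOrderedRing R]

/-- **Row 2′TRI on `K₅ + {a₃o, a₃u, a₃b}`**: every weight-free typed count of `K₃` is nonnegative. -/
theorem typedBases_oub : CovForm.TypedBases (R := R) (ends13 0 3 4) 0 1 2 5 4 :=
  typedBases 0 3 4 litOK_oub cert_oub

/-- **THEOREM 28 on the triple `(0, 3, 4)`: (HCOV) on `K₅ + {a₃o, a₃u, a₃b}` for every weight vector** (missing edges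
at weight `0`). -/
theorem HCov_deg3_oub (p : Fin 13 → R) (hp : IsProbVec p) : CovForm.HCov p (ends13 0 3 4) 0 1 2 5 4 :=
  HCov_deg3 0 3 4 litOK_oub cert_oub p hp

end Deg3

end Summit.Ventures.PercRepro2
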